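import Summits.Ventures.PercRepro.S2TopFiveHit
import Summits.Ventures.PercRepro.S2TriangleThree
import Summits.Ventures.PercRepro.S2FifteenSix
import Summits.Ventures.PercRepro.S2FifteenSixScaled
import Summits.Ventures.PercRepro.S2PhiFourteenFive

/-!
# PercRepro — S2: THE SPREAD CASE OF THE CELL `(14, 6)` COLOOP-FREE — THE HITTING LEVER (p7, gen 14; sub-claim S2; the `p = 14` row)

The spread case (no set of nullity `4` on `≤ 9` points: rank-`5` sets have `≤ 8` points, rank-`4` sets `≤ 7`) of the coloop-free
cell `(14, 6)` (caps `s₃ ≤ 10`, `s₄ ≤ 35`, `s₅ ≤ 156`, `s₆ ≤ 462`; `K = 12417`, `Φ(14, 5) ≤ 2^19/K`), per exact `t = s₃`, with the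
rank part of the tail at the exact `t` (`ncard_eRk_le_five_le_spread`) and the top count split into the top `5`-sets (the HITTING
LEVER of S2TopFiveHit: every top `5`-set meets the union of any two distinct circuits) and the top `6`-sets (the cobasis charge per
triangle, `S2.ncard_top_six_le`): `t = 0` — two `4`-circuits (`#top5 ≤ C(20,5) − C(12,5)`), else two `5`-circuits (`− C(10,5)`), else the
charge is tiny; `t = 1` — the triangle with a `4`-circuit (`− C(13,5)`) or a `5`-circuit (`− C(12,5)`); `t = 2` — the two triangles
(`− C(14,5)`); `t ≥ 3` — a top `5`-set misses at most one of three triangles (`#top5 ≤ 12787`), the charge per triangle `680`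
(`t ≤ 4`), `394` (Lemma A, `5 ≤ t ≤ 7`), `316` (a disjoint triangle, `t = 8`), `172` (two triangles avoiding it, `t ≥ 9`); the
spanning count by the kit (`t ≤ 2`) or three triangles' Bonferroni (`38347`, `t ≥ 3`). Every numeral from
lean-drafts/p7/g14/mining/gen146spread.py (plan146.py). **`ThmN.c025_fourteen_six_cf_spread`**. Axioms: standard.
-/

open scoped Matroid

namespace PercRepro

namespace ThmN

open Set

variable {α : Type}


/-- **The spread case of the coloop-free cell `(14, 6)`**, per `t = s₃` (see the module docstring for the numbers). -/
theorem c025_fourteen_six_cf_spread (M : Matroid α) [M.Finite]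
    (hR : M.eRank = ((14 : ℕ) : ℕ∞)) (hn : M.E.ncard = 14 + 6)
    (hfree : ∀ e ∈ M.E, ∃ A ⊆ M.E \ {e}, e ∉ M.closure A ∧ e ∉ M.closure ((M.E \ {e}) \ A)) (hK : ∀ e, ¬ M.IsColoop e)
    (h4 : ¬ ∃ W ⊆ M.E, W.ncard ≤ 9 ∧ W.encard = M.eRk W + 4) : RLS M 14 5 := by
  classical
  have hd : M.E.encard = M.eRank + ((6 : ℕ) : ℕ∞) := by
    rw [hR, ← M.ground_finite.cast_ncard_eq, hn]
    push_cast
    ring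
  obtain ⟨hs3, hs4, hs5⟩ := caps_fourteen_six_scaled_cf M hd hn hfree hK
  have hflat : ∀ X ⊆ M.E, M.eRk X ≤ 5 → X.ncard ≤ 8 := fun X hX hr => by
    have := S2.ncard_le_of_eRk_le_of_not_nullity M 4 9 (by norm_num) h4 hX (r := 5) (by norm_num) (by exact_mod_cast hr)
    omega
  have hflat' : ∀ X ⊆ M.E, M.eRk X ≤ 4 → X.ncard ≤ 7 := fun X hX hr => by
    have := S2.ncard_le_of_eRk_le_of_not_nullity M 4 9 (by norm_num) h4 hX (r := 4) (by norm_num) (by exact_mod_cast hr)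
    omega
  have hEcard : M.ground_finite.toFinset.card = 14 + 6 := by
    rw [← Set.ncard_eq_toFinset_card _ M.ground_finite]; exact hn
  have hL0 : ∀ e ∈ M.E, ¬ M.IsLoop e := not_isLoop_of_free M hfree
  have hs : ∀ e ∈ M.E, ∀ f ∈ M.E, e ≠ f → M.eRk {e, f} = 2 := by
    intro e he f hf hef
    have h2 : (2 : ℕ∞) ≤ M.eRk {e, f} :=
      two_le_eRk_of_two_le_ncard_of_free M hfree (pair_subset he hf) (by rw [ncard_pair hef])
    have h3 : M.eRk {e, f} ≤ 2 := by
      have := M.eRk_le_encard {e, f}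
      rwa [encard_pair hef] at this
    exact le_antisymm h3 h2
  have hC1 : ∀ L ⊆ M.E, M.eRk L = 2 → L.ncard ≤ 3 :=
    fun L hL hr => ncard_le_three_of_eRk_two M hs hfree hL hr
  have hcirc : ∀ C, M.IsCircuit C → 3 ≤ C.encard := three_le_encard_of_circuit M hL0 hs
  have hTfin : {C : Set α | M.IsCircuit C ∧ C.ncard = 3}.Finite :=
    M.ground_finite.finite_subsets.subset (fun C hC => hC.1.subset_ground)
  have h4fin : {C : Set α | M.IsCircuit C ∧ C.ncard = 4}.Finite :=
    M.ground_finite.finite_subsets.subset (fun C hC => hC.1.subset_ground)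
  have h5fin : {C : Set α | M.IsCircuit C ∧ C.ncard = 5}.Finite :=
    M.ground_finite.finite_subsets.subset (fun C hC => hC.1.subset_ground)
  have h9 : ∀ X ⊆ M.E, X.ncard ≤ 9 → X.encard ≤ M.eRk X + 3 := by
    intro X hX hX9
    by_contra hlt
    push Not at hlt
    have hk : M.eRk X + 4 ≤ X.encard := by
      have := Order.add_one_le_of_lt hlt
      rwa [add_assoc, show (3 : ℕ∞) + 1 = 4 by norm_num] at this
    obtain ⟨W', hW'X, hW'⟩ := S2.exists_subset_encard_eq_eRk_add M hX 4 hk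
    exact h4 ⟨W', hW'X.trans hX, (Set.ncard_le_ncard hW'X (M.ground_finite.subset hX)).trans hX9, hW'⟩
  have hs6 : {C : Set α | M.IsCircuit C ∧ C.ncard = 6}.ncard ≤ (6 + 5).choose 6 :=
    Matroid.ncard_circuits_le_choose_of_encard M hd 5
  norm_num [Nat.choose] at hs6
  have cellA : ∀ (U S m : ℕ) (A : ℚ), Matroid.topCount M 14 5 ≤ U → {X : Set α | X ⊆ M.E ∧ M.eRk X = M.eRank}.ncard ≤ S → m ≤ 1024 →
      1024 * (U : ℚ) ≤ ((1024 - m : ℕ) : ℚ) * 2 ^ (6 - 5) * (12417 : ℚ) →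
      (1024 : ℚ) * (A + (S : ℚ)) ≤ (m : ℚ) * 2 ^ 20 →
      ({X : Set α | X ⊆ M.E ∧ M.eRk X ≤ 5}.ncard : ℚ) ≤ A → RLS M 14 5 := by
    intro U S m A hU hS hm hpoly htail hA
    rw [RLS_iff]
    exact c025_core_five_cell_of_counts_xqictq5g M 14 6 (by norm_num) hR hn U hU _ hA S hS
      12417 (by norm_num) (phiK 14 5) (by rw [S2.phiK_fourteen_five]; norm_num) ⟨m, hm, hpoly, htail⟩
  -- the top count is the top `5`-sets plus the top `6`-sets
  have hU1 := S2.topCount_le_ncard_compl_spanning (M := M) hR hd 5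
  simp only [Nat.cast_ofNat] at hU1
  have hsplit : {B : Set α | B ⊆ M.E ∧ M.eRk B = 5 ∧ B.ncard ≤ 6 ∧ M.eRk (M.E \ B) = M.eRank}.ncard ≤
      {B : Set α | B ⊆ M.E ∧ B.ncard = 5 ∧ M.eRk B = 5 ∧ M.eRk (M.E \ B) = M.eRank}.ncard +
      {B : Set α | B ⊆ M.E ∧ B.ncard = 6 ∧ M.eRk B = 5 ∧ M.eRk (M.E \ B) = M.eRank}.ncard := by
    refine le_trans (Set.ncard_le_ncard ?_ ((M.ground_finite.finite_subsets.subset (fun B hB => hB.1)).union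
      (M.ground_finite.finite_subsets.subset (fun B hB => hB.1)))) (Set.ncard_union_le _ _)
    rintro B ⟨hBE, hB5, hB6, hBs⟩
    have hBfin : B.Finite := M.ground_finite.subset hBE
    have h5le : 5 ≤ B.ncard := by
      have := M.eRk_le_encard B
      rw [hB5, ← hBfin.cast_ncard_eq] at this
      exact_mod_cast this
    rcases (show B.ncard = 5 ∨ B.ncard = 6 by omega) with h | h
    · exact Or.inl ⟨hBE, h, hB5, hBs⟩
    · exact Or.inr ⟨hBE, h, hB5, hBs⟩
  have hUsum : Matroid.topCount M 14 5 ≤ {B : Set α | B ⊆ M.E ∧ B.ncard = 5 ∧ M.eRk B = 5 ∧ M.eRk (M.E \ B) = M.eRank}.ncard + {B : Set α | B ⊆ M.E ∧ B.ncard = 6 ∧ M.eRk B = 5 ∧ M.eRk (M.E \ B) = M.eRank}.ncard := hU1.trans hsplit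
  -- the top `5`-sets against two sets they all meet
  have htop5_le : ∀ (Y₁ Y₂ : Set α), (∀ B ⊆ M.E, B.ncard = 5 → M.eRk (M.E \ B) = M.eRank → (B ∩ Y₁).Nonempty) →
      (∀ B ⊆ M.E, B.ncard = 5 → M.eRk (M.E \ B) = M.eRank → (B ∩ Y₂).Nonempty) →
      {B : Set α | B ⊆ M.E ∧ B.ncard = 5 ∧ M.eRk B = 5 ∧ M.eRk (M.E \ B) = M.eRank}.ncard + (M.E \ Y₁).ncard.choose 5 + (M.E \ Y₂).ncard.choose 5 ≤ 15504 + (M.E \ (Y₁ ∪ Y₂)).ncard.choose 5 := by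
    intro Y₁ Y₂ h1 h2
    have := S2.ncard_top_five_add_le_of_hit M Y₁ Y₂ h1 h2
    rw [hn] at this
    norm_num [Nat.choose] at this
    exact this
  have htop5_all : {B : Set α | B ⊆ M.E ∧ B.ncard = 5 ∧ M.eRk B = 5 ∧ M.eRk (M.E \ B) = M.eRank}.ncard ≤ 15504 := by
    have hsub : {B : Set α | B ⊆ M.E ∧ B.ncard = 5 ∧ M.eRk B = 5 ∧ M.eRk (M.E \ B) = M.eRank} ⊆ {X : Set α | X ⊆ M.E ∧ X.ncard = 5} := fun B hB => ⟨hB.1, hB.2.1⟩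
    have := Set.ncard_le_ncard hsub (M.ground_finite.finite_subsets.subset (fun X hX => hX.1))
    rw [S2.ncard_subsets_ncard_eq M.E M.ground_finite 5, hn] at this
    norm_num [Nat.choose] at this
    exact this
  -- the complement of a union of two circuits: `|E ∖ (C₁ ∪ C₂)| ≥ 20 − |C₁| − |C₂|`
  have hcompl : ∀ {C₁ C₂ : Set α}, C₁ ⊆ M.E → C₂ ⊆ M.E → 20 ≤ (M.E \ (C₁ ∪ C₂)).ncard + C₁.ncard + C₂.ncard := by
    intro C₁ C₂ h₁ h₂
    have hY : C₁ ∪ C₂ ⊆ M.E := Set.union_subset h₁ h₂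
    have h := Set.ncard_sdiff_add_ncard_of_subset hY M.ground_finite
    have hu := Set.ncard_union_le C₁ C₂
    omega
  -- the top `6`-sets through circuits, with a per-triangle charge `c`
  have htop6_le : ∀ (c : ℕ), (∀ T : Set α, M.IsCircuit T → T.ncard = 3 →
      {B : Set α | B ⊆ M.E ∧ B.ncard = 6 ∧ T ⊆ B ∧ M.eRk (M.E \ B) = M.eRank}.ncard ≤ c) →
      {B : Set α | B ⊆ M.E ∧ B.ncard = 6 ∧ M.eRk B = 5 ∧ M.eRk (M.E \ B) = M.eRank}.ncard ≤ {C : Set α | M.IsCircuit C ∧ C.ncard = 3}.ncard * c + {C : Set α | M.IsCircuit C ∧ C.ncard = 4}.ncard * 120 + {C : Set α | M.IsCircuit C ∧ C.ncard = 5}.ncard * 15 + 462 := by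
    intro c hc
    have := S2.ncard_top_six_le M hn hcirc c hc
    norm_num [Nat.choose] at this
    omega
  have hc680 : ∀ T : Set α, M.IsCircuit T → T.ncard = 3 →
      {B : Set α | B ⊆ M.E ∧ B.ncard = 6 ∧ T ⊆ B ∧ M.eRk (M.E \ B) = M.eRank}.ncard ≤ 680 := by
    intro T hT hT3
    have hsub : {B : Set α | B ⊆ M.E ∧ B.ncard = 6 ∧ T ⊆ B ∧ M.eRk (M.E \ B) = M.eRank} ⊆
        {X : Set α | X ⊆ M.E ∧ X.ncard = 6 ∧ T ⊆ X} := fun B hB => ⟨hB.1, hB.2.1, hB.2.2.1⟩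
    have h := (Set.ncard_le_ncard hsub (M.ground_finite.finite_subsets.subset (fun X hX => hX.1))).trans
      (S2.ncard_subsets_superset_le M hT.subset_ground 6)
    rw [hn, hT3] at h
    norm_num [Nat.choose] at h
    exact h
  -- the spanning counts
  have hSkit : {X : Set α | X ⊆ M.E ∧ M.eRk X = M.eRank}.ncard ≤ 60460 := by
    have hS := Matroid.ncard_spanning_le (M := M) hd
    rw [hEcard] at hS
    exact hS.trans (by decide)
  have hspan3 : 3 ≤ {C : Set α | M.IsCircuit C ∧ C.ncard = 3}.ncard → {X : Set α | X ⊆ M.E ∧ M.eRk X = M.eRank}.ncard ≤ 38347 := by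
    intro h3
    obtain ⟨T₁, T₂, T₃, hT₁, hT₂, hT₃, h12, h13, h23⟩ := (Set.two_lt_ncard_iff hTfin).1 (by omega)
    have hS := S2.ncard_spanning_add_le_of_three_triangles M hR hn (by norm_num) hC1 hT₁.1 hT₁.2 hT₂.1 hT₂.2 hT₃.1 hT₃.2 h12 h13 h23
    norm_num [Finset.sum_range_succ, Nat.choose] at hS
    omega
  -- the exact triangle count `t` and the rank part of the tail at `t`
  obtain ⟨t, ht⟩ : ∃ t, {C : Set α | M.IsCircuit C ∧ C.ncard = 3}.ncard = t := ⟨_, rfl⟩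
  have hA := ncard_eRk_le_five_le_spread M 14 6 (by norm_num) hR hn hfree hflat hflat' t 35 156 ht.le hs4 hs5
  rw [ht] at hs3 hspan3 htop6_le

  by_cases ht0 : t = 0
  · subst ht0
    by_cases h42 : 2 ≤ {C : Set α | M.IsCircuit C ∧ C.ncard = 4}.ncard
    · -- two `4`-circuits: every top `5`-set meets their union of `≤ 8` points
      obtain ⟨C₁, C₂, hC₁, hC₂, hne⟩ := (Set.one_lt_ncard_iff h4fin).1 (by omega)
      have hhit := S2.top_five_inter_union_nonempty M hR hn hC₁.1 hC₂.1 hne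
      have h5b := htop5_le (C₁ ∪ C₂) (C₁ ∪ C₂) hhit hhit
      rw [Set.union_self] at h5b
      have hY := hcompl hC₁.1.subset_ground hC₂.1.subset_ground
      rw [hC₁.2, hC₂.2] at hY
      have hch : (12 : ℕ).choose 5 ≤ (M.E \ (C₁ ∪ C₂)).ncard.choose 5 := Nat.choose_le_choose 5 (by omega)
      norm_num [Nat.choose] at hch
      have h6 := htop6_le 680 hc680
      have hU' : Matroid.topCount M 14 5 ≤ 21714 := by omega
      exact cellA _ 60460 100 _ hU' hSkit (by norm_num) (by norm_num) (by norm_num [Nat.choose]) hA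
    push Not at h42
    by_cases h52 : 2 ≤ {C : Set α | M.IsCircuit C ∧ C.ncard = 5}.ncard
    · -- two `5`-circuits: their union has `≤ 10` points
      obtain ⟨C₁, C₂, hC₁, hC₂, hne⟩ := (Set.one_lt_ncard_iff h5fin).1 (by omega)
      have hhit := S2.top_five_inter_union_nonempty M hR hn hC₁.1 hC₂.1 hne
      have h5b := htop5_le (C₁ ∪ C₂) (C₁ ∪ C₂) hhit hhit
      rw [Set.union_self] at h5b
      have hY := hcompl hC₁.1.subset_ground hC₂.1.subset_ground
      rw [hC₁.2, hC₂.2] at hY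
      have hch : (10 : ℕ).choose 5 ≤ (M.E \ (C₁ ∪ C₂)).ncard.choose 5 := Nat.choose_le_choose 5 (by omega)
      norm_num [Nat.choose] at hch
      have h6 := htop6_le 680 hc680
      have hU' : Matroid.topCount M 14 5 ≤ 18174 := by omega
      exact cellA _ 60460 100 _ hU' hSkit (by norm_num) (by norm_num) (by norm_num [Nat.choose]) hA
    · push Not at h52
      have h6 := htop6_le 680 hc680
      have hU' : Matroid.topCount M 14 5 ≤ 16101 := by omega
      exact cellA _ 60460 100 _ hU' hSkit (by norm_num) (by norm_num) (by norm_num [Nat.choose]) hA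
  by_cases ht1 : t = 1
  · subst ht1
    obtain ⟨T, hTeq⟩ := Set.ncard_eq_one.1 ht
    have hT : M.IsCircuit T ∧ T.ncard = 3 := by
      have : T ∈ {C : Set α | M.IsCircuit C ∧ C.ncard = 3} := by rw [hTeq]; exact Set.mem_singleton T
      exact this
    by_cases h41 : 1 ≤ {C : Set α | M.IsCircuit C ∧ C.ncard = 4}.ncard
    · -- the triangle and a `4`-circuit: their union has `≤ 7` points
      obtain ⟨C, hC⟩ := Set.nonempty_of_ncard_ne_zero (s := {C : Set α | M.IsCircuit C ∧ C.ncard = 4}) (by omega)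
      have hne : T ≠ C := fun h => by have h3 := hT.2; rw [h, hC.2] at h3; omega
      have hhit := S2.top_five_inter_union_nonempty M hR hn hT.1 hC.1 hne
      have h5b := htop5_le (T ∪ C) (T ∪ C) hhit hhit
      rw [Set.union_self] at h5b
      have hY := hcompl hT.1.subset_ground hC.1.subset_ground
      rw [hT.2, hC.2] at hY
      have hch : (13 : ℕ).choose 5 ≤ (M.E \ (T ∪ C)).ncard.choose 5 := Nat.choose_le_choose 5 (by omega)
      norm_num [Nat.choose] at hch
      have h6 := htop6_le 680 hc680
      have hU' : Matroid.topCount M 14 5 ≤ 21899 := by omega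
      exact cellA _ 60460 101 _ hU' hSkit (by norm_num) (by norm_num) (by norm_num [Nat.choose]) hA
    push Not at h41
    by_cases h51 : 1 ≤ {C : Set α | M.IsCircuit C ∧ C.ncard = 5}.ncard
    · -- the triangle and a `5`-circuit: their union has `≤ 8` points
      obtain ⟨C, hC⟩ := Set.nonempty_of_ncard_ne_zero (s := {C : Set α | M.IsCircuit C ∧ C.ncard = 5}) (by omega)
      have hne : T ≠ C := fun h => by have h3 := hT.2; rw [h, hC.2] at h3; omega
      have hhit := S2.top_five_inter_union_nonempty M hR hn hT.1 hC.1 hne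
      have h5b := htop5_le (T ∪ C) (T ∪ C) hhit hhit
      rw [Set.union_self] at h5b
      have hY := hcompl hT.1.subset_ground hC.1.subset_ground
      rw [hT.2, hC.2] at hY
      have hch : (12 : ℕ).choose 5 ≤ (M.E \ (T ∪ C)).ncard.choose 5 := Nat.choose_le_choose 5 (by omega)
      norm_num [Nat.choose] at hch
      have h6 := htop6_le 680 hc680
      have hU' : Matroid.topCount M 14 5 ≤ 18194 := by omega
      exact cellA _ 60460 101 _ hU' hSkit (by norm_num) (by norm_num) (by norm_num [Nat.choose]) hA
    · push Not at h51
      have h6 := htop6_le 680 hc680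
      have hU' : Matroid.topCount M 14 5 ≤ 16646 := by omega
      exact cellA _ 60460 101 _ hU' hSkit (by norm_num) (by norm_num) (by norm_num [Nat.choose]) hA
  by_cases ht2 : t = 2
  · subst ht2
    obtain ⟨T₁, T₂, hT₁, hT₂, hne⟩ := (Set.one_lt_ncard_iff hTfin).1 (by omega)
    have hhit := S2.top_five_inter_union_nonempty M hR hn hT₁.1 hT₂.1 hne
    have h5b := htop5_le (T₁ ∪ T₂) (T₁ ∪ T₂) hhit hhit
    rw [Set.union_self] at h5b
    have hY := hcompl hT₁.1.subset_ground hT₂.1.subset_ground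
    rw [hT₁.2, hT₂.2] at hY
    have hch : (14 : ℕ).choose 5 ≤ (M.E \ (T₁ ∪ T₂)).ncard.choose 5 := Nat.choose_le_choose 5 (by omega)
    norm_num [Nat.choose] at hch
    have h6 := htop6_le 680 hc680
    have hU' : Matroid.topCount M 14 5 ≤ 21864 := by omega
    exact cellA _ 60460 102 _ hU' hSkit (by norm_num) (by norm_num) (by norm_num [Nat.choose]) hA
  -- `t ≥ 3`: a top `5`-set misses at most one of three triangles
  have ht3 : 3 ≤ t := by omega
  have hS' := hspan3 ht3
  have htop5_3 : {B : Set α | B ⊆ M.E ∧ B.ncard = 5 ∧ M.eRk B = 5 ∧ M.eRk (M.E \ B) = M.eRank}.ncard ≤ 12787 := by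
    obtain ⟨T₁, T₂, T₃, hT₁, hT₂, hT₃, h12, h13, h23⟩ := (Set.two_lt_ncard_iff hTfin).1 (by omega)
    obtain ⟨hT₁c, hT₁3⟩ := hT₁
    obtain ⟨hT₂c, hT₂3⟩ := hT₂
    obtain ⟨hT₃c, hT₃3⟩ := hT₃
    have hfin : ∀ {T : Set α}, M.IsCircuit T → T.Finite := fun hT => M.ground_finite.subset hT.subset_ground
    have hhit₂ := S2.top_five_inter_union_nonempty M hR hn hT₁c hT₂c h12
    have hhit₃ := S2.top_five_inter_union_nonempty M hR hn hT₁c hT₃c h13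
    have h5b := htop5_le (T₁ ∪ T₂) (T₁ ∪ T₃) hhit₂ hhit₃
    -- the sizes of the complements
    have hY₁ : T₁ ∪ T₂ ⊆ M.E := Set.union_subset hT₁c.subset_ground hT₂c.subset_ground
    have hY₂ : T₁ ∪ T₃ ⊆ M.E := Set.union_subset hT₁c.subset_ground hT₃c.subset_ground
    have ha := Set.ncard_sdiff_add_ncard_of_subset hY₁ M.ground_finite
    have hb := Set.ncard_sdiff_add_ncard_of_subset hY₂ M.ground_finite
    have hu12 := Set.ncard_union_le T₁ T₂
    have hu13 := Set.ncard_union_le T₁ T₃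
    have hl12 := S2.five_le_ncard_union_of_triangles M hC1 hT₁c hT₁3 hT₂c hT₂3 h12
    have hl13 := S2.five_le_ncard_union_of_triangles M hC1 hT₁c hT₁3 hT₃c hT₃3 h13
    have hu123 : (T₁ ∪ T₂ ∪ (T₁ ∪ T₃)).ncard ≤ 9 := by
      have hsub : T₁ ∪ T₂ ∪ (T₁ ∪ T₃) ⊆ (T₁ ∪ T₂) ∪ T₃ :=
        Set.union_subset Set.subset_union_left
          (Set.union_subset (Set.subset_union_left.trans Set.subset_union_left) Set.subset_union_right)
      have h1 := Set.ncard_le_ncard hsub (((hfin hT₁c).union (hfin hT₂c)).union (hfin hT₃c))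
      have h2 := Set.ncard_union_le (T₁ ∪ T₂) T₃
      omega
    have hc := Set.ncard_sdiff_add_ncard_of_subset (Set.union_subset hY₁ hY₂) M.ground_finite
    -- `T₃` has a point outside `T₁ ∪ T₂`, `T₂` one outside `T₁ ∪ T₃`
    obtain ⟨x, hx₃, hx₁₂⟩ := exists_mem_triangle_notMem_union M hC1 hT₁c hT₁3 hT₂c hT₂3 hT₃c hT₃3 h13 h23
    obtain ⟨y, hy₂, hy₁₃⟩ := exists_mem_triangle_notMem_union M hC1 hT₁c hT₁3 hT₃c hT₃3 hT₂c hT₂3 h12 (Ne.symm h23)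
    have hca : (M.E \ (T₁ ∪ T₂ ∪ (T₁ ∪ T₃))).ncard + 1 ≤ (M.E \ (T₁ ∪ T₂)).ncard := by
      have hxmem : x ∈ M.E \ (T₁ ∪ T₂) := ⟨hT₃c.subset_ground hx₃, hx₁₂⟩
      have hsub : M.E \ (T₁ ∪ T₂ ∪ (T₁ ∪ T₃)) ⊆ (M.E \ (T₁ ∪ T₂)) \ {x} := by
        rintro z ⟨hzE, hz⟩
        refine ⟨⟨hzE, fun h => hz (Or.inl h)⟩, fun hzx => hz (Or.inr (Or.inr (by rw [Set.mem_singleton_iff.1 hzx]; exact hx₃)))⟩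
      have := Set.ncard_le_ncard hsub (M.ground_finite.sdiff.sdiff)
      have h1 := Set.ncard_sdiff_singleton_add_one hxmem (M.ground_finite.sdiff)
      omega
    have hcb : (M.E \ (T₁ ∪ T₂ ∪ (T₁ ∪ T₃))).ncard + 1 ≤ (M.E \ (T₁ ∪ T₃)).ncard := by
      have hymem : y ∈ M.E \ (T₁ ∪ T₃) := ⟨hT₂c.subset_ground hy₂, hy₁₃⟩
      have hsub : M.E \ (T₁ ∪ T₂ ∪ (T₁ ∪ T₃)) ⊆ (M.E \ (T₁ ∪ T₃)) \ {y} := by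
        rintro z ⟨hzE, hz⟩
        refine ⟨⟨hzE, fun h => hz (Or.inr h)⟩, fun hzy => hz (Or.inl (Or.inr (by rw [Set.mem_singleton_iff.1 hzy]; exact hy₂)))⟩
      have := Set.ncard_le_ncard hsub (M.ground_finite.sdiff.sdiff)
      have h1 := Set.ncard_sdiff_singleton_add_one hymem (M.ground_finite.sdiff)
      omega
    exact top_five_le_of_three_bound {B : Set α | B ⊆ M.E ∧ B.ncard = 5 ∧ M.eRk B = 5 ∧ M.eRk (M.E \ B) = M.eRank}.ncard _ _ _ (by omega) (by omega) (by omega) (by omega) (by omega) (by omega) hca hcb h5b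
  by_cases ht4 : t ≤ 4
  · have h6 := htop6_le 680 hc680
    rcases (show t = 3 ∨ t = 4 by omega) with ht3e | ht4e
    · subst ht3e
      have hU' : Matroid.topCount M 14 5 ≤ 21829 := by omega
      exact cellA _ 38347 82 _ hU' hS' (by norm_num) (by norm_num) (by norm_num [Nat.choose]) hA
    · subst ht4e
      have hU' : Matroid.topCount M 14 5 ≤ 22509 := by omega
      exact cellA _ 38347 83 _ hU' hS' (by norm_num) (by norm_num) (by norm_num [Nat.choose]) hA
  push Not at ht4
  by_cases ht7 : t ≤ 7
  · -- Lemma A: a circuit of `≤ 4` points avoids every triangle once `s₃ ≥ 5`; the cobasis charge `≤ 394`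
    have hc394 : ∀ T : Set α, M.IsCircuit T → T.ncard = 3 →
        {B : Set α | B ⊆ M.E ∧ B.ncard = 6 ∧ T ⊆ B ∧ M.eRk (M.E \ B) = M.eRank}.ncard ≤ 394 := by
      intro T hT hT3
      obtain ⟨C', hC', hC'4, hdis⟩ := exists_circuit_le_four_disjoint_of_five_triangles_set M hC1 (by omega) hT hT3
      have hC'fin : C'.Finite := M.ground_finite.subset hC'.subset_ground
      have hC'3 : 3 ≤ C'.ncard := by
        have := hcirc C' hC'
        rw [← hC'fin.cast_ncard_eq] at this
        exact_mod_cast this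
      have h := S2.ncard_cobases_through_add_le M hR hn hT.subset_ground hC' hdis (by omega)
      rw [hn, hT3] at h
      generalize hc : C'.ncard = c at h hC'3 hC'4
      interval_cases c <;> norm_num [Nat.choose] at h <;> omega
    have h6 := htop6_le 394 hc394
    rcases (show t = 5 ∨ t = 6 ∨ t = 7 by omega) with ht5e | ht6e | ht7e
    · subst ht5e
      have hU' : Matroid.topCount M 14 5 ≤ 21759 := by omega
      exact cellA _ 38347 84 _ hU' hS' (by norm_num) (by norm_num) (by norm_num [Nat.choose]) hA
    · subst ht6e
      have hU' : Matroid.topCount M 14 5 ≤ 22153 := by omega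
      exact cellA _ 38347 85 _ hU' hS' (by norm_num) (by norm_num) (by norm_num [Nat.choose]) hA
    · subst ht7e
      have hU' : Matroid.topCount M 14 5 ≤ 22547 := by omega
      exact cellA _ 38347 86 _ hU' hS' (by norm_num) (by norm_num) (by norm_num [Nat.choose]) hA
  push Not at ht7
  by_cases ht8 : t ≤ 8
  · -- a disjoint triangle: the cobasis charge `≤ 316`
    have hc316 : ∀ T : Set α, M.IsCircuit T → T.ncard = 3 →
        {B : Set α | B ⊆ M.E ∧ B.ncard = 6 ∧ T ⊆ B ∧ M.eRk (M.E \ B) = M.eRank}.ncard ≤ 316 := by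
      intro T hT hT3
      obtain ⟨T', hT', hT'3, hdis⟩ := S2.exists_disjoint_triangle_of_eight M hC1 h9 (by omega) hT hT3
      have h := S2.ncard_cobases_through_add_le M hR hn hT.subset_ground hT' hdis (by omega)
      rw [hn, hT3, hT'3] at h
      norm_num [Nat.choose] at h
      omega
    have h6 := htop6_le 316 hc316
    have ht8e : t = 8 := by omega
    subst ht8e
    have hU' : Matroid.topCount M 14 5 ≤ 22317 := by omega
    exact cellA _ 38347 88 _ hU' hS' (by norm_num) (by norm_num) (by norm_num [Nat.choose]) hA
  · push Not at ht8
    -- two triangles avoiding `T`: the cobasis charge `≤ 172`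
    have hc172 : ∀ T : Set α, M.IsCircuit T → T.ncard = 3 →
        {B : Set α | B ⊆ M.E ∧ B.ncard = 6 ∧ T ⊆ B ∧ M.eRk (M.E \ B) = M.eRank}.ncard ≤ 172 := by
      intro T hT hT3
      obtain ⟨T', T'', hT', hT'3, hd', hT'', hT''3, hd'', hne⟩ :=
        S2.exists_two_disjoint_triangles_of_nine M hC1 h9 (by omega) hT hT3
      have h := S2.ncard_cobases_through_add_le_two M hR hn hT.subset_ground hT3 hT' hT'' hd' hd''
      have hZ : (M.E \ T).ncard = 17 := by
        rw [Set.ncard_sdiff hT.subset_ground (M.ground_finite.subset hT.subset_ground), hn, hT3]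
      have hT'Z : T' ⊆ M.E \ T := Set.subset_sdiff.2 ⟨hT'.subset_ground, hd'⟩
      have hT''Z : T'' ⊆ M.E \ T := Set.subset_sdiff.2 ⟨hT''.subset_ground, hd''⟩
      have h1 : ((M.E \ T) \ T').ncard = 14 := by
        rw [Set.ncard_sdiff hT'Z (M.ground_finite.subset hT'.subset_ground), hZ, hT'3]
      have h2 : ((M.E \ T) \ T'').ncard = 14 := by
        rw [Set.ncard_sdiff hT''Z (M.ground_finite.subset hT''.subset_ground), hZ, hT''3]
      have hu := S2.five_le_ncard_union_of_triangles M hC1 hT' hT'3 hT'' hT''3 hne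
      have h3 : ((M.E \ T) \ (T' ∪ T'')).ncard ≤ 12 := by
        rw [Set.ncard_sdiff (Set.union_subset hT'Z hT''Z) (M.ground_finite.subset (Set.union_subset hT'.subset_ground hT''.subset_ground)), hZ]
        omega
      have hch : ((M.E \ T) \ (T' ∪ T'')).ncard.choose 3 ≤ (12 : ℕ).choose 3 := Nat.choose_le_choose 3 h3
      rw [hZ, h1, h2] at h
      norm_num [Nat.choose] at h hch
      omega
    have h6 := htop6_le 172 hc172
    rcases (show t = 9 ∨ t = 10 by omega) with ht9e | ht10e
    · subst ht9e
      have hU' : Matroid.topCount M 14 5 ≤ 21337 := by omega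
      exact cellA _ 38347 89 _ hU' hS' (by norm_num) (by norm_num) (by norm_num [Nat.choose]) hA
    · subst ht10e
      have hU' : Matroid.topCount M 14 5 ≤ 21509 := by omega
      exact cellA _ 38347 90 _ hU' hS' (by norm_num) (by norm_num) (by norm_num [Nat.choose]) hA

end ThmN

end PercRepro
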